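import Literature.Analysis.FluidPDE.LinearisedNSFourierData
import HarnessLib

/-!
# Synthesis of the solution of the linearised Navier–Stokes equation: smoothness, dictionary, datum

Analysis/FluidPDE proof file, seventh of the files `LinearisedNSFourier*` (objects in
`LinearisedNSFourierDefs`; the Fourier-side package in `LinearisedNSFourierData`). For `ν > 0`,
`T > 0`, a background `u` jointly smooth and divergence free on `[0, T] × T^d` and a smooth
divergence-free mean-zero datum `w₀` (Constantin–Foias 1988, Ch. 14, (14.3)), the coefficient
field `c = solCoeff ν T u w₀` and the synthesized fields satisfy (`synth_spec`):

* the complex velocity components `Vₗ = velC ν T u w₀ l = ∑ₖ c(l,t,k) e_k` and the complex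
  pressure `Q = presC ν T u w₀` are jointly smooth on `[0, T] × T^d`
  (`ScalarFourier.isSmoothSpaceTimeOn_torusSynth`: families of every order,
  `LinearisedNSFourierData.solCoeff_spec`, `exists_presFamily`), hence so are their real parts
  `vel`, `pres`;
* the Fourier dictionary at `t ∈ [0, T]`: `𝓕(Vₗ) = cₗ` (all `t`),
  `𝓕(∂ₜVₗ) = -νₖcₗ - (P linSym)ₗ` (`ScalarFourier.timeDerivWithin_torusSynth` and the
  differentiated mild equation), `𝓕(Q) = q̂`;
* the datum: `Vₗ(0, x) = (w₀(x)ₗ : ℂ)` by pointwise Fourier inversion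
  (`ScalarFourier.tsum_mFourierCoeff_mul_mFourier`, Grafakos 2014, §3.3.1), hence
  `vel ν T u w₀ 0 = w₀`.

## References

* P. Constantin, C. Foias, *Navier–Stokes Equations*, Univ. Chicago Press 1988, Ch. 14, (14.3). [`ConstantinFoiasNSE1988`]
* L. Grafakos, *Classical Fourier Analysis*, 3rd ed. (2014), Prop. 3.2.7, §3.3.1. [`Grafakos2014`]
-/

noncomputable section

open MeasureTheory Real Set Filter Topology UnitAddTorus

namespace Literature.Analysis.FluidPDE

namespace LinearisedNSFourier

open scoped ContDiff
open ScalarFourier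
open CorrectorFourier (leraySym driftCoeff)
open FourierNS (HasDecay clamp)
open Literature.Analysis.FunctionSpaces.Torus (freqNormSq IsSmoothSpaceTimeOn IsSmooth)

variable {d : Type*} [Fintype d] [DecidableEq d]
variable {ν T : ℝ} {u : ℝ → UnitAddTorus d → EuclideanSpace ℝ d}
  {w₀ : UnitAddTorus d → EuclideanSpace ℝ d}

/-- **The synthesized fields of the solution of the linearised equation.** For `ν > 0`,
`T > 0`, a jointly smooth divergence-free background `u` on `[0, T] × T^d` and a smooth
divergence-free mean-zero datum `w₀`: the complex velocity components `Vₗ = velC ν T u w₀ l`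
and the complex pressure `Q = presC ν T u w₀` are jointly smooth on `[0, T] × T^d`, and so
are the real velocity `vel ν T u w₀` and pressure `pres ν T u w₀`; the Fourier coefficients
are `𝓕(Vₗ(t)) = c(l,t,·)` (all `t`), `𝓕(∂ₜVₗ(t)) = -νₖ cₗ - (P linSym)ₗ` and
`𝓕(Q(t)) = q̂(t,·)` for `t ∈ [0, T]` (Grafakos 2014, §3.3.1, Prop. 3.2.7); and the datum is
attained, `Vₗ(0, x) = (w₀(x)ₗ : ℂ)` (pointwise Fourier inversion), so `vel ν T u w₀ 0 = w₀`. [folklore] -/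
theorem synth_spec (hν : 0 < ν) (hT : 0 < T) (hu : IsSmoothSpaceTimeOn (Icc 0 T) u)
    (hdiv : ∀ t ∈ Icc 0 T, FunctionSpaces.Torus.IsDivFree (u t)) (hw₀ : IsSmooth w₀)
    (hw₀div : FunctionSpaces.Torus.IsDivFree w₀) (hw₀mean : FunctionSpaces.Torus.HasZeroMean w₀) :
    (∀ l, IsSmoothSpaceTimeOn (Icc 0 T) (velC ν T u w₀ l)) ∧
    IsSmoothSpaceTimeOn (Icc 0 T) (presC ν T u w₀) ∧
    IsSmoothSpaceTimeOn (Icc 0 T) (vel ν T u w₀) ∧ IsSmoothSpaceTimeOn (Icc 0 T) (pres ν T u w₀) ∧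
    (∀ l t k, mFourierCoeff (velC ν T u w₀ l t) k = solCoeff ν T u w₀ l t k) ∧
    (∀ l, ∀ t ∈ Icc 0 T, ∀ k,
      mFourierCoeff (FunctionSpaces.Torus.timeDerivWithin (Icc 0 T) (velC ν T u w₀ l) t) k =
      -(heatRate ν k : ℂ) * solCoeff ν T u w₀ l t k -
        linProjSym (fun j => driftCoeff T u j t) (fun j => solCoeff ν T u w₀ j t) l k) ∧
    (∀ t ∈ Icc 0 T, ∀ k, mFourierCoeff (presC ν T u w₀ t) k = presCoeffField ν T u w₀ t k) ∧
    (∀ l x, velC ν T u w₀ l 0 x = ((w₀ x l : ℝ) : ℂ)) ∧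
    vel ν T u w₀ 0 = w₀ := by
  obtain ⟨hcc, hdecay, hdivF, hzero, hdatum, hderiv, hfam⟩ :=
    solCoeff_spec hν hT hu hdiv hw₀ hw₀div hw₀mean
  have hUS : UniqueDiffOn ℝ (Icc 0 T) := uniqueDiffOn_Icc hT
  -- summability of the coefficients at every time
  obtain ⟨C₀, -, hC₀⟩ := hdecay (latOrder d)
  have hsum : ∀ l t, Summable fun k => ‖solCoeff ν T u w₀ l t k‖ := fun l t =>
    summable_norm_of_hasDecay le_rfl (hC₀ l t)
  -- smoothness of the complex fields
  have hV : ∀ l, IsSmoothSpaceTimeOn (Icc 0 T) (velC ν T u w₀ l) := fun l =>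
    isSmoothSpaceTimeOn_torusSynth hT fun n => by
      obtain ⟨W, hW0, hW⟩ := hfam n
      exact ⟨W l, hW0 l, hW l⟩
  have hQ : IsSmoothSpaceTimeOn (Icc 0 T) (presC ν T u w₀) :=
    isSmoothSpaceTimeOn_torusSynth hT fun n => by
      obtain ⟨W, hW0, hW⟩ := hfam n
      exact exists_presFamily hT hu hW0 hW
  -- smoothness of the real fields
  have hvel : IsSmoothSpaceTimeOn (Icc 0 T) (vel ν T u w₀) := by
    change ContDiffOn ℝ ∞ (FunctionSpaces.Torus.stLift (vel ν T u w₀)) (Icc 0 T ×ˢ univ)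
    rw [contDiffOn_euclidean]
    intro l
    exact (hV l).clm_comp Complex.reCLM
  have hpres : IsSmoothSpaceTimeOn (Icc 0 T) (pres ν T u w₀) := hQ.clm_comp Complex.reCLM
  -- the dictionary
  have hcV : ∀ l t k, mFourierCoeff (velC ν T u w₀ l t) k = solCoeff ν T u w₀ l t k := fun l t k =>
    mFourierCoeff_tsum_mul_mFourier (hsum l t) k
  have hcVt : ∀ l, ∀ t ∈ Icc 0 T, ∀ k,
      mFourierCoeff (FunctionSpaces.Torus.timeDerivWithin (Icc 0 T) (velC ν T u w₀ l) t) k =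
      -(heatRate ν k : ℂ) * solCoeff ν T u w₀ l t k -
        linProjSym (fun j => driftCoeff T u j t) (fun j => solCoeff ν T u w₀ j t) l k := by
    intro l t ht k
    obtain ⟨W, hW0, hW⟩ := hfam 1
    have hW1 : ∀ m, W l 1 t m = -(heatRate ν m : ℂ) * solCoeff ν T u w₀ l t m -
        linProjSym (fun j => driftCoeff T u j t) (fun j => solCoeff ν T u w₀ j t) l m := by
      intro m
      have h1 := (hW l).deriv 0 (by norm_num) m t ht
      rw [hW0] at h1
      exact (h1.derivWithin (hUS t ht)).symm.trans ((hderiv l m t ht).derivWithin (hUS t ht))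
    have hdt : ∀ x, FunctionSpaces.Torus.timeDerivWithin (Icc 0 T) (velC ν T u w₀ l) t x =
        torusSynth (W l 1) t x := by
      intro x
      have := timeDerivWithin_torusSynth hT (hW l) ht x
      rwa [hW0] at this
    obtain ⟨C1, -, hC1⟩ := (hW l).decay_nonneg le_rfl (latOrder d)
    have hsum1 : Summable fun m => ‖W l 1 t m‖ := summable_norm_of_hasDecay le_rfl (hC1 t ht)
    have hfun : FunctionSpaces.Torus.timeDerivWithin (Icc 0 T) (velC ν T u w₀ l) t =
        fun x => ∑' m, W l 1 t m * mFourier m x := funext hdt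
    rw [hfun, mFourierCoeff_tsum_mul_mFourier hsum1 k, hW1 k]
  have hcQ : ∀ t ∈ Icc 0 T, ∀ k, mFourierCoeff (presC ν T u w₀ t) k = presCoeffField ν T u w₀ t k := by
    intro t ht k
    obtain ⟨W, hW0, hW⟩ := hfam 0
    obtain ⟨Qf, hQ0, hQf⟩ := exists_presFamily hT hu hW0 hW
    obtain ⟨C0, -, hC0'⟩ := hQf.decay_nonneg le_rfl (latOrder d)
    have hsumQ : Summable fun m => ‖presCoeffField ν T u w₀ t m‖ := by
      have := summable_norm_of_hasDecay le_rfl (hC0' t ht)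
      rwa [hQ0] at this
    exact mFourierCoeff_tsum_mul_mFourier hsumQ k
  -- the datum
  have hV0 : ∀ l x, velC ν T u w₀ l 0 x = ((w₀ x l : ℝ) : ℂ) := by
    intro l x
    have hg : IsSmooth (fun y => ((w₀ y l : ℝ) : ℂ)) := isSmooth_datumComp hw₀ l
    change (∑' k, solCoeff ν T u w₀ l 0 k * mFourier k x) = _
    have hc0 : solCoeff ν T u w₀ l 0 = datumCoeff w₀ l := funext fun k => hdatum l k
    rw [hc0]
    exact tsum_mFourierCoeff_mul_mFourier hg.continuous (summable_norm_mFourierCoeff hg) x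
  refine ⟨hV, hQ, hvel, hpres, hcV, hcVt, hcQ, hV0, ?_⟩
  funext x
  ext l
  rw [vel_apply, hV0 l x, Complex.ofReal_re]

end LinearisedNSFourier

end Literature.Analysis.FluidPDE

end
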